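import Summits.AtomisticToContinuum.Crystallization.Theorems.FrustratedLawDichotomyAtlasReachErgodic

/-!
# FrustratedLawDichotomy · crux `AperiodicFrustratedLawGap` (stmt-AtomisticToContinuum-27623) — THE ATLAS DOOR'S RESIDUAL REDUCES TO ERGODIC LAWS
# (decomp-a2c hand-2 g51, STRUCTURAL share of the registered residual `stub_aperiodicErgodicGap`, sequel of #135 `…AtlasReachErgodic`)

#135 reduced every HALF-LINE MASS regime of (404) (`c ≤ P(U)`, `P(U) < c`) to ergodic laws.  The residual hypothesis the K-file production actually
plugs into is the atlas door's (228) `…AtlasDoor.ResidualCoreDeficit n K mK` — «for every admissible minimising law the mean deficit of the uncovered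
roots is below the booked credit `Σ_{i<n} m_i·P(rowCell K i)`» — an AFFINE condition on the law (a set integral of the root energy against masses of
cells), not the mass of one set.  This file extends the reduction to affine regimes and hence to the door:

* §1 (pure measure theory, the general lemma) **bounded real observables are DETECTED by kernel mixtures**: for a probability mixture `P = Q.bind F` with
  almost surely probability components and a bounded measurable `h`, `c ≤ ∫ h dP` forces `c ≤ ∫ h d(F ω)` for a non-null set of `ω`
  (`frequently_le_integral_of_bind`) and `∫ h dP < c` forces `∫ h d(F ω) < c` frequently (`frequently_integral_lt_of_bind`) — #135's `lintegral` lemmas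
  applied to the nonnegative shift `ofReal (h + B)` (the tree's `integral_eq_toReal_lintegral_sub`).
* §2 `noAdmissibleMinimiserWith_of_ergodic'` — #135 §3 with a richer detection interface: the detector may also use that almost every component is almost
  surely rooted `7/10`-hard-core and point-stationary (needed whenever the regime mentions `rootEnergy`, which is only controlled on hard-core
  configurations).
* §3 ★★ the door: `residualCoreDeficit_iff` (the residual hypothesis IS the regime «credit ≤ residual deficit» of (404)'s `NoAdmissibleMinimiserWith`),
  `integral_residualObservable` (that regime is `0 ≤ ∫ h dP` for ONE bounded measurable observable `h = 1_U·(e⋆ − G) − Σ m_i 1_{rowCell i}`, `G` the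
  tree's clamped measurable root energy), and ★★ `residualCoreDeficit_of_ergodic`: `ResidualCoreDeficit n K mK` follows from its ERGODIC restriction —
  so (228) `aperiodicFrustratedLawGap_of_atlas` may be fed a residual proved for ERGODIC admissible minimising laws only
  (`aperiodicFrustratedLawGap_of_atlas_ergodic`, the crux BY NAME).

HONEST LABELS.  Junction / bookkeeping only; nothing is priced.  Together with #135 every residual currency of the 27623 atlas programme (A(η), F(η),
`ResidualCoreDeficit`) now carries the ergodicity clause of the registered stub for free.  DEF-FREE (theorems only); imports TREE #135 `…AtlasReachErgodic`
only; no instance / notation / option; 0 sorry.  Tags: §1 [folklore: measure theory], §2–§3 [new: junction].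
-/

noncomputable section

namespace Summit.AtomisticToContinuum.Crystallization.Theorems.FrustratedLawDichotomyAtlasDoorErgodic

open MeasureTheory Set Filter
open scoped ENNReal BigOperators
open Literature.MathematicalPhysics.StatisticalMechanics (lennardJones rootEnergy PeriodicConfiguration)
open Literature.Probability.Process (IsRootedHardCore IsPointStationaryLaw)
open Literature.Probability.Process.LocalConfig (RootedHardCoreConfig)
open Summit.AtomisticToContinuum.Crystallization.Theorems.ChargedEnergyGapNegative (E3 eStar)
open Summit.AtomisticToContinuum.Crystallization.Theorems.FrustratedLawDichotomyMarginLedger (rowCell measurableSet_rowCell)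
open Summit.AtomisticToContinuum.Crystallization.Theorems.FrustratedLawDichotomyAtlasDoor (ResidualCoreDeficit aperiodicFrustratedLawGap_of_atlas)
open Summit.AtomisticToContinuum.Crystallization.Theorems.FrustratedLawDichotomyAtlasReach (NoAdmissibleMinimiserWith)
open Summit.AtomisticToContinuum.Crystallization.Theorems.FrustratedLawDichotomyErgodicReduction
  (exists_measurable_bounded_rootEnergy integral_eq_toReal_lintegral_sub lintegral_ofReal_add_le
    kernelDecomposition_of_aeErgodic aeErgodic_condExpKernel_hErg)
open Summit.AtomisticToContinuum.Crystallization.Theorems.FrustratedLawDichotomyAtlasReachErgodic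
  (frequently_le_lintegral_of_bind frequently_lintegral_lt_of_bind ae_admissible_of_bind)

/-! ## §1. Bounded real observables are detected by kernel mixtures (pure measure theory) -/

section Detect

variable {Ω α : Type*} [MeasurableSpace Ω] [MeasurableSpace α] {Q : Measure Ω} {F : Ω → Measure α}

/-- ★ **AFFINE LOWER HALF-SPACES ARE DETECTED.**  For a probability mixture `P = Q.bind F` whose components are almost surely probability measures and a
bounded measurable real observable `h` (`|h| ≤ B`): `c ≤ ∫ h dP` ⟹ `c ≤ ∫ h d(F ω)` for a non-null set of indices `ω` (#135
`frequently_le_lintegral_of_bind` for `ofReal (h + B)`). [folklore: measure theory] -/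
theorem frequently_le_integral_of_bind [IsProbabilityMeasure Q] (hF : Measurable F) (hprob : ∀ᵐ ω ∂Q, IsProbabilityMeasure (F ω))
    [IsProbabilityMeasure (Q.bind F)] {h : α → ℝ} (hh : Measurable h) {B : ℝ} (hB : ∀ a, |h a| ≤ B) {c : ℝ}
    (hc : c ≤ ∫ a, h a ∂(Q.bind F)) : ∃ᵐ ω ∂Q, c ≤ ∫ a, h a ∂(F ω) := by
  have hg : Measurable fun a => ENNReal.ofReal (h a + B) := ENNReal.measurable_ofReal.comp (hh.add_const B)
  have hfin : ∫⁻ a, ENNReal.ofReal (h a + B) ∂(Q.bind F) ≠ ∞ :=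
    ((lintegral_ofReal_add_le (Q := Q.bind F) hB).trans_lt ENNReal.ofReal_lt_top).ne
  have hP : ∫ a, h a ∂(Q.bind F) = (∫⁻ a, ENNReal.ofReal (h a + B) ∂(Q.bind F)).toReal - B :=
    integral_eq_toReal_lintegral_sub hh hB
  have h1 : ENNReal.ofReal (c + B) ≤ ∫⁻ a, ENNReal.ofReal (h a + B) ∂(Q.bind F) := by
    rw [ENNReal.ofReal_le_iff_le_toReal hfin]
    linarith
  refine ((frequently_le_lintegral_of_bind hF hg hfin h1).and_eventually hprob).mono fun ω hω => ?_
  obtain ⟨hω, hprobω⟩ := hω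
  haveI := hprobω
  have hω' : ∫ a, h a ∂(F ω) = (∫⁻ a, ENNReal.ofReal (h a + B) ∂(F ω)).toReal - B :=
    integral_eq_toReal_lintegral_sub hh hB
  have hfinω : ∫⁻ a, ENNReal.ofReal (h a + B) ∂(F ω) ≠ ∞ :=
    ((lintegral_ofReal_add_le (Q := F ω) hB).trans_lt ENNReal.ofReal_lt_top).ne
  rw [ENNReal.ofReal_le_iff_le_toReal hfinω] at hω
  linarith

/-- ★ **AFFINE UPPER HALF-SPACES ARE DETECTED**: `∫ h dP < c` ⟹ `∫ h d(F ω) < c` for a non-null set of indices (#135 `frequently_lintegral_lt_of_bind`).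
[folklore: measure theory] -/
theorem frequently_integral_lt_of_bind [IsProbabilityMeasure Q] (hF : Measurable F) (hprob : ∀ᵐ ω ∂Q, IsProbabilityMeasure (F ω))
    [IsProbabilityMeasure (Q.bind F)] {h : α → ℝ} (hh : Measurable h) {B : ℝ} (hB : ∀ a, |h a| ≤ B) {c : ℝ}
    (hc : ∫ a, h a ∂(Q.bind F) < c) : ∃ᵐ ω ∂Q, ∫ a, h a ∂(F ω) < c := by
  have hg : Measurable fun a => ENNReal.ofReal (h a + B) := ENNReal.measurable_ofReal.comp (hh.add_const B)
  have hfin : ∫⁻ a, ENNReal.ofReal (h a + B) ∂(Q.bind F) ≠ ∞ :=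
    ((lintegral_ofReal_add_le (Q := Q.bind F) hB).trans_lt ENNReal.ofReal_lt_top).ne
  have hP : ∫ a, h a ∂(Q.bind F) = (∫⁻ a, ENNReal.ofReal (h a + B) ∂(Q.bind F)).toReal - B :=
    integral_eq_toReal_lintegral_sub hh hB
  have h1 : ∫⁻ a, ENNReal.ofReal (h a + B) ∂(Q.bind F) < ENNReal.ofReal (c + B) := by
    rw [ENNReal.lt_ofReal_iff_toReal_lt hfin]
    linarith
  refine ((frequently_lintegral_lt_of_bind hF hg h1).and_eventually hprob).mono fun ω hω => ?_
  obtain ⟨hω, hprobω⟩ := hω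
  haveI := hprobω
  have hω' : ∫ a, h a ∂(F ω) = (∫⁻ a, ENNReal.ofReal (h a + B) ∂(F ω)).toReal - B :=
    integral_eq_toReal_lintegral_sub hh hB
  have h2 := ENNReal.toReal_lt_of_lt_ofReal hω
  linarith

end Detect

/-! ## §2. The ergodic reduction of a regime, with the hard-core / stationarity information passed to the detector -/

/-- ★ **ERGODIC REDUCTION OF A REGIME (richer detection interface).**  As #135 `noAdmissibleMinimiserWith_of_ergodic`, but the detector `hdet` may use
that `Q`-almost every component `F ω` is a probability law that is ALMOST SURELY ROOTED `7/10`-HARD-CORE and POINT-STATIONARY (all three delivered by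
#135 `ae_admissible_of_bind`): for every such-detected regime `X`, `NoAdmissibleMinimiserWith X` follows from `NoAdmissibleMinimiserWith (X ∧ ergodic)`.
[new: junction] -/
theorem noAdmissibleMinimiserWith_of_ergodic' {X : Measure (Measure E3) → Prop}
    (hdet : ∀ P : Measure (Measure E3), IsProbabilityMeasure P → (∀ᵐ μ ∂P, IsRootedHardCore (7 / 10) μ) →
      ∀ Q : Measure (RootedHardCoreConfig E3 (7 / 10)), IsProbabilityMeasure Q →
      ∀ F : RootedHardCoreConfig E3 (7 / 10) → Measure (Measure E3), Measurable F → Q.bind F = P →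
      (∀ᵐ ω ∂Q, IsProbabilityMeasure (F ω) ∧ (∀ᵐ μ ∂F ω, IsRootedHardCore (7 / 10) μ) ∧ IsPointStationaryLaw (F ω)) →
      X P → ∃ᵐ ω ∂Q, X (F ω))
    (h : NoAdmissibleMinimiserWith fun P => X P ∧ ∀ A : Set (Measure E3), MeasurableSet A →
      (∀ μ : Measure E3, ∀ p : E3, μ {p} ≠ 0 → (μ ∈ A ↔ Measure.map (fun z : E3 => z - p) μ ∈ A)) → P A = 0 ∨ P Aᶜ = 0) :
    NoAdmissibleMinimiserWith X := by
  intro P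
  dsimp only
  intro hP ha hb hd he h0 hmin hX
  haveI := hP
  obtain ⟨R₇, R₈, R₉, hd'⟩ := hd
  obtain ⟨Q, hQ, F, hF, hbind, hcomp⟩ :=
    kernelDecomposition_of_aeErgodic aeErgodic_condExpKernel_hErg (7 / 10) (by norm_num) P hP ha hb
  haveI := hQ
  have hae := ae_admissible_of_bind (by norm_num : (0 : ℝ) < 7 / 10) ha hd' he h0 hmin hF hbind
    (𝓔 := fun P' : Measure (Measure E3) => ∀ A : Set (Measure E3), MeasurableSet A →
      (∀ μ : Measure E3, ∀ p : E3, μ {p} ≠ 0 → (μ ∈ A ↔ Measure.map (fun z : E3 => z - p) μ ∈ A)) → P' A = 0 ∨ P' Aᶜ = 0)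
    hcomp
  have hfreq : ∃ᵐ ω ∂Q, X (F ω) :=
    hdet P hP ha Q hQ F hF hbind (hae.mono fun ω hω => ⟨hω.1, hω.2.1, hω.2.2.1⟩) hX
  obtain ⟨ω, hXω, hprob, hcω, hstat, herg, h1, h2, h3, henω⟩ := (hfreq.and_eventually hae).exists
  have hω := h (F ω)
  dsimp only at hω
  exact hω hprob hcω hstat ⟨R₇, R₈, R₉, h1⟩ h2 h3 henω ⟨hXω, herg⟩

/-! ## §3. ★★ The atlas door's residual hypothesis reduces to ergodic laws -/

variable {n : ℕ} {K : ℕ → Set (Measure E3)} {mK : ℕ → ℝ}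

/-- ★ **THE RESIDUAL HYPOTHESIS IS A REGIME.**  (228) `ResidualCoreDeficit n K mK` is (404)'s `NoAdmissibleMinimiserWith` for the regime «booked credit
`Σ_{i<n} m_i·P(rowCell K i)` ≤ residual deficit `∫_U (e⋆ − rootEnergy) dP`» (same binder list; `a < b` versus `¬ b ≤ a`). [new: bookkeeping] -/
theorem residualCoreDeficit_iff (n : ℕ) (K : ℕ → Set (Measure E3)) (mK : ℕ → ℝ) :
    ResidualCoreDeficit n K mK ↔ NoAdmissibleMinimiserWith fun P =>
      ∑ i ∈ Finset.range n, mK i * P.real (rowCell K i) ≤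
        ∫ μ in (⋃ i ∈ Finset.range n, K i)ᶜ, (eStar - rootEnergy lennardJones μ) ∂P := by
  constructor
  · intro h P
    have h' := h P
    dsimp only at h' ⊢
    intro hP ha hb hd he h0 hmin hX
    exact absurd (h' hP ha hb hd he h0 hmin) (not_lt.2 hX)
  · intro h P
    have h' := h P
    dsimp only at h' ⊢
    intro hP ha hb hd he h0 hmin
    exact not_le.1 fun hX => h' hP ha hb hd he h0 hmin hX

/-- ★ **THE RESIDUAL REGIME IS AFFINE IN THE LAW.**  With `G` the tree's clamped measurable root energy at hard core `7/10` (`|G| ≤ B`, `G = rootEnergy` on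
rooted `7/10`-hard-core configurations) and the bounded measurable observable `h μ := 1_U(μ)·(e⋆ − G μ) − Σ_{i<n} m_i·1_{rowCell K i}(μ)`: for every
probability law `P` almost surely carried by rooted `7/10`-hard-core configurations, `∫ h dP = ∫_U (e⋆ − rootEnergy) dP − Σ_{i<n} m_i·P(rowCell K i)`.
[new: bookkeeping] -/
theorem integral_residualObservable (hK : ∀ i, MeasurableSet (K i)) {B : ℝ} {G : Measure E3 → ℝ} (hG : Measurable G) (hGB : ∀ μ, |G μ| ≤ B)
    (hGeq : ∀ μ, IsRootedHardCore (7 / 10) μ → G μ = rootEnergy lennardJones μ)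
    (P : Measure (Measure E3)) [IsProbabilityMeasure P] (hcore : ∀ᵐ μ ∂P, IsRootedHardCore (7 / 10) μ) :
    ∫ μ, ((⋃ i ∈ Finset.range n, K i)ᶜ.indicator (fun μ => eStar - G μ) μ -
        ∑ i ∈ Finset.range n, mK i * (rowCell K i).indicator 1 μ) ∂P =
      (∫ μ in (⋃ i ∈ Finset.range n, K i)ᶜ, (eStar - rootEnergy lennardJones μ) ∂P) -
        ∑ i ∈ Finset.range n, mK i * P.real (rowCell K i) := by
  have hU : MeasurableSet (⋃ i ∈ Finset.range n, K i)ᶜ := (Finset.measurableSet_biUnion _ fun j _ => hK j).compl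
  have hmeas1 : Measurable fun μ => (⋃ i ∈ Finset.range n, K i)ᶜ.indicator (fun μ => eStar - G μ) μ :=
    (measurable_const.sub hG).indicator hU
  have hbd1 : ∀ μ, ‖(⋃ i ∈ Finset.range n, K i)ᶜ.indicator (fun μ => eStar - G μ) μ‖ ≤ |eStar| + B := by
    intro μ
    rw [Real.norm_eq_abs]
    by_cases hμ : μ ∈ (⋃ i ∈ Finset.range n, K i)ᶜ
    · rw [Set.indicator_of_mem hμ]
      have := hGB μ
      exact (abs_sub _ _).trans (by linarith)
    · rw [Set.indicator_of_notMem hμ, abs_zero]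
      have := hGB μ
      linarith [abs_nonneg eStar, abs_nonneg (G μ)]
  have hint1 : Integrable (fun μ => (⋃ i ∈ Finset.range n, K i)ᶜ.indicator (fun μ => eStar - G μ) μ) P :=
    Integrable.of_bound hmeas1.aestronglyMeasurable (|eStar| + B) (Eventually.of_forall hbd1)
  have hint2i : ∀ i ∈ Finset.range n, Integrable (fun μ => mK i * (rowCell K i).indicator 1 μ) P := fun i _ =>
    ((integrable_const (1 : ℝ)).indicator (measurableSet_rowCell hK i)).const_mul (mK i)
  have hint2 : Integrable (fun μ => ∑ i ∈ Finset.range n, mK i * (rowCell K i).indicator 1 μ) P :=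
    integrable_finsetSum _ hint2i
  rw [integral_sub hint1 hint2, integral_finsetSum _ hint2i, integral_indicator hU]
  congr 1
  · refine setIntegral_congr_ae hU ?_
    filter_upwards [hcore] with μ hμ _
    rw [hGeq μ hμ]
  · refine Finset.sum_congr rfl fun i _ => ?_
    rw [integral_const_mul, integral_indicator_one (measurableSet_rowCell hK i)]

/-- ★★ **THE ATLAS DOOR'S RESIDUAL HYPOTHESIS REDUCES TO ERGODIC LAWS.**  If every ERGODIC admissible minimising law (clauses (a)(b)(d)(e), aperiodic,
`E[rootEnergy] ≤ e⋆`, every measurable re-rooting-invariant set trivial) has residual deficit of the uncovered roots below the booked credit — i.e. no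
ergodic admissible minimising law lies in the regime «credit ≤ residual» — then `ResidualCoreDeficit n K mK` holds for ALL admissible minimising laws:
the regime is `0 ≤ ∫ h dP` for the bounded observable of `integral_residualObservable`, detected by kernel mixtures (§1), so §2 applies.
[new: junction] -/
theorem residualCoreDeficit_of_ergodic (hK : ∀ i, MeasurableSet (K i))
    (h : NoAdmissibleMinimiserWith fun P =>
      (∑ i ∈ Finset.range n, mK i * P.real (rowCell K i) ≤
        ∫ μ in (⋃ i ∈ Finset.range n, K i)ᶜ, (eStar - rootEnergy lennardJones μ) ∂P) ∧
      ∀ A : Set (Measure E3), MeasurableSet A →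
      (∀ μ : Measure E3, ∀ p : E3, μ {p} ≠ 0 → (μ ∈ A ↔ Measure.map (fun z : E3 => z - p) μ ∈ A)) → P A = 0 ∨ P Aᶜ = 0) :
    ResidualCoreDeficit n K mK := by
  rw [residualCoreDeficit_iff]
  refine noAdmissibleMinimiserWith_of_ergodic' (fun P hP ha Q hQ F hF hbind hcomp hX => ?_) h
  haveI := hP
  haveI := hQ
  obtain ⟨B, _, G, hG, hGB, hGeq⟩ := exists_measurable_bounded_rootEnergy (by norm_num : (0 : ℝ) < 7 / 10)
  have hU : MeasurableSet (⋃ i ∈ Finset.range n, K i)ᶜ := (Finset.measurableSet_biUnion _ fun j _ => hK j).compl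
  -- the observable and its bound
  set hobs : Measure E3 → ℝ := fun μ => (⋃ i ∈ Finset.range n, K i)ᶜ.indicator (fun μ => eStar - G μ) μ -
    ∑ i ∈ Finset.range n, mK i * (rowCell K i).indicator 1 μ with hobs_def
  have hmeas : Measurable hobs :=
    ((measurable_const.sub hG).indicator hU).sub
      (Finset.measurable_sum _ fun i _ => (measurable_const.indicator (measurableSet_rowCell hK i)).const_mul (mK i))
  have hbd : ∀ μ, |hobs μ| ≤ |eStar| + B + ∑ i ∈ Finset.range n, |mK i| := by
    intro μ
    have h1 : |(⋃ i ∈ Finset.range n, K i)ᶜ.indicator (fun μ => eStar - G μ) μ| ≤ |eStar| + B := by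
      by_cases hμ : μ ∈ (⋃ i ∈ Finset.range n, K i)ᶜ
      · rw [Set.indicator_of_mem hμ]
        have := hGB μ
        exact (abs_sub _ _).trans (by linarith)
      · rw [Set.indicator_of_notMem hμ, abs_zero]
        have := hGB μ
        linarith [abs_nonneg eStar, abs_nonneg (G μ)]
    have h2 : |∑ i ∈ Finset.range n, mK i * (rowCell K i).indicator 1 μ| ≤ ∑ i ∈ Finset.range n, |mK i| := by
      refine (Finset.abs_sum_le_sum_abs _ _).trans (Finset.sum_le_sum fun i _ => ?_)
      rw [abs_mul]
      have h3 : |(rowCell K i).indicator (1 : Measure E3 → ℝ) μ| ≤ 1 := by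
        by_cases hμ : μ ∈ rowCell K i
        · rw [Set.indicator_of_mem hμ, Pi.one_apply, abs_one]
        · rw [Set.indicator_of_notMem hμ, abs_zero]; exact zero_le_one
      calc |mK i| * |(rowCell K i).indicator 1 μ| ≤ |mK i| * 1 := mul_le_mul_of_nonneg_left h3 (abs_nonneg _)
        _ = |mK i| := mul_one _
    calc |hobs μ| ≤ |(⋃ i ∈ Finset.range n, K i)ᶜ.indicator (fun μ => eStar - G μ) μ| +
          |∑ i ∈ Finset.range n, mK i * (rowCell K i).indicator 1 μ| := abs_sub _ _
      _ ≤ |eStar| + B + ∑ i ∈ Finset.range n, |mK i| := by linarith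
  -- the regime at `P` reads `0 ≤ ∫ hobs dP`
  haveI : IsProbabilityMeasure (Q.bind F) := by rw [hbind]; exact hP
  have hXP : (0 : ℝ) ≤ ∫ μ, hobs μ ∂(Q.bind F) := by
    rw [hbind, hobs_def, integral_residualObservable hK hG hGB hGeq P ha]
    linarith
  -- detect, and read the regime back at the component
  refine (frequently_le_integral_of_bind hF (hcomp.mono fun ω hω => hω.1) hmeas hbd hXP |>.and_eventually hcomp).mono
    fun ω hω => ?_
  obtain ⟨hω, hprobω, hcω, -⟩ := hω
  haveI := hprobω
  have hωeq := integral_residualObservable (n := n) (K := K) (mK := mK) hK hG hGB hGeq (F ω) hcω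
  rw [hωeq] at hω
  linarith

/-- ★★ **THE ATLAS DOOR WITH AN ERGODIC RESIDUAL (route decl, by name).**  A finite row atlas with deterministic floors `e⋆ + m_i ≤ rootEnergy` at every
rooted `7/10`-hard-core Nash configuration of each row (the K-files' `hfloor` lines of (228), verbatim), plus the residual-core deficit hypothesis FOR
ERGODIC LAWS ONLY, proves `AperiodicFrustratedLawGap` ((228) `aperiodicFrustratedLawGap_of_atlas` after `residualCoreDeficit_of_ergodic`).
[new: junction] -/
theorem aperiodicFrustratedLawGap_of_atlas_ergodic (n : ℕ) (K : ℕ → Set (Measure E3)) (hK : ∀ i, MeasurableSet (K i)) (mK : ℕ → ℝ)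
    (hfloor : ∀ i < n, ∀ μ : Measure E3, IsRootedHardCore (7 / 10) μ →
      (∀ p : E3, μ {p} ≠ 0 → ∀ y : E3, (∀ q : E3, μ {q} ≠ 0 → q ≠ p → y ≠ q) →
        ∑' q : {q : E3 // μ {q} ≠ 0 ∧ q ≠ p}, lennardJones (dist p (q : E3)) ≤ ∑' q : {q : E3 // μ {q} ≠ 0 ∧ q ≠ p}, lennardJones (dist y (q : E3))) →
      μ ∈ K i → eStar + mK i ≤ rootEnergy lennardJones μ)
    (hres : NoAdmissibleMinimiserWith fun P =>
      (∑ i ∈ Finset.range n, mK i * P.real (rowCell K i) ≤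
        ∫ μ in (⋃ i ∈ Finset.range n, K i)ᶜ, (eStar - rootEnergy lennardJones μ) ∂P) ∧
      ∀ A : Set (Measure E3), MeasurableSet A →
      (∀ μ : Measure E3, ∀ p : E3, μ {p} ≠ 0 → (μ ∈ A ↔ Measure.map (fun z : E3 => z - p) μ ∈ A)) → P A = 0 ∨ P Aᶜ = 0) :
    Summit.AtomisticToContinuum.Crystallization.Theses.FrustratedLawDichotomy.AperiodicFrustratedLawGap :=
  aperiodicFrustratedLawGap_of_atlas n K hK mK hfloor (residualCoreDeficit_of_ergodic hK hres)

end Summit.AtomisticToContinuum.Crystallization.Theorems.FrustratedLawDichotomyAtlasDoorErgodic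

end
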